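import Summits.BirchSwinnertonDyer.BirchSwinnertonDyer.Theorems.ByReductionTypeAtTwoSupersingularThetaHabitat
import Summits.BirchSwinnertonDyer.BirchSwinnertonDyer.Theorems.ThetaPartnerAtTwoTwoTorsionCongruence
import HarnessLib

/-!
# Route `ByReductionTypeAtTwo` (rung K4), crux `SupersingularRankZeroAtTwo` (item stmt-BirchSwinnertonDyer-19097), line
# `signed_halves_two`: the HARDEST stub (3) `stub_zeroKobayashiLower` (Eisenstein half `KobayashiLowerDivisibility W 2 1`)
# — indeed Kobayashi's full `+` MAIN CONJECTURE at `2` — ON THE THETA HABITAT, from route `ThetaPartnerAtTwo`'s K1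
# (transport, 20333) + K2r0 (CM main conjecture, 20312) BY NAME and 19097's own stubs (1) (1′) (4)
# (seat `bsd-2adic-ss-1x`, WIDTH-LEVER second lane; memo CROSS-ROUTE-TP2-K3K4-v1 §3 «complementary», RC-138 (3))

HONEST FRAMING (cell `bsd-2adic`, run/shared/lean/pub/bsd-2adic/, HUMAN RULINGS D-0036/D-0054/D-0074): THEOREMS ONLY — no
definition, no named fact, no instance, no `sorry`; every research input is a displayed binder (TP2's K1/K2r0 are OPEN cruxes
of route ThetaPartnerAtTwo; stub (4) is 19097's Coleman–Kato package READ AT 2); closes none; nothing booked; BSD is NOT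
proved by any of this. PARTITION (D-0054): X5@2 good-SUPERSINGULAR, `a₂ = 0` THETA-HABITAT sub-row (19 of the 208 rank-`0`
`a₂ = 0` census classes) × `p = 2` — types-the-object-of (stub (3) of line `signed_halves_two` AT the habitat); bears_on:
K4-leaf 19097 (stub (3)) · TP2 K1 20333 / K2r0 20312 / K3 20308.

## What is proved (the converse consumption: TP2's θ-objects ⟹ a 19097 STUB, on the habitat)

TP2's K1 `SignedTransportAtTwo` outputs, for a habitat curve `E` with CM partner `A`, Kobayashi's `+` main conjecture
`KobayashiMainConjecture E 2 1` from: the partner's analytic data (produced from modularity and `L(A,1) ≠ 0` exactly as in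
`Theses.ThetaPartnerAtTwo.closes`), K2r0 at `A`, and K3 at `E`. The main conjecture contains the Eisenstein half
(`kobayashiLowerDivisibility_of_mainConjecture`, `h = 1`). Hence:

* `kobayashiMainConjecture_two_of_cmPartner_of_thetaPartnerItems` — per curve: modularity + K1 + K2r0 + K3 + an explicit
  rank-`0` CM partner `A` with `E[2] ≃ A[2]` ⟹ `KobayashiMainConjecture E 2 1` (the INTEGRAL signed main conjecture at `2`
  for a non-CM curve — what TP2 buys on its habitat, as a Theorems-side statement about `E`).
* `kobayashiLowerDivisibility_two_of_cmPartner_of_thetaPartnerItems` — hence stub (3)'s conclusion at `E`.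
* `zeroKobayashiLower_onHabitat_of_thetaPartnerItems` / `…_of_signedTransport_of_stubs` — ∀-closed over the habitat:
  **19097's stub (3) `stub_zeroKobayashiLower` RESTRICTED TO THE THETA HABITAT follows from modularity + TP2 K1 + K2r0 + K3,
  resp. + 19097's stubs (1′) `stub_katoPub` + (4) `stub_zeroColemanKato` in place of K3** (`ThetaPartnerXRoute.
  signedKatoDivisibilityUpToAtTwo_of_zeroColemanKato`). The MATH-BOUND Eisenstein half thus has a second, independent road
  on 19/208 classes: GL₁ elliptic units of the CM field at the inert prime `2` + congruence transport, instead of a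
  Beilinson–Flach/Kato lower bound for `E` itself.
* `kobayashiMainConjecture_two_baseChange_int_of_thetaPartner` — integer-model door for the per-class displays (partner and
  congruence kernel-decided by a Tschirnhaus certificate, `ThetaPartnerXRoute.exists_equivariant_addEquiv_geomTorsion_two_of_tschirnhaus`).

References: [Kobayashi2003] Conjecture p. 2, Thm. 1.2, Thm. 4.1; [GreenbergVatsal2000] Thm. (1.4); [BDKim2009] Cor. 2.13;
[PollackRubin2004] Thm. 7.3; [Rubin1991] Thm. 12.3; [BurungaleFlach2024] Thm. 4.1; [Kato2004Asterisque] Thm. 12.4–12.5;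
[KuriharaOtsuki2006] p. 564; memo run/shared/lean/pub/bsd-wall/bsd-wall-p2/xroute/CROSS-ROUTE-TP2-K3K4-v1.md; RC-138.
-/

set_option autoImplicit false
-- the Theorems namespace of this sub repeats the summit name by design (D-0017 nested layout)
set_option linter.dupNamespace false

noncomputable section

open scoped Classical MatrixGroups ModularForm Polynomial

open CongruenceSubgroup WeierstrassCurve Literature.NumberTheory.EllipticCurves
  Literature.NumberTheory.EllipticCurves.ModularForms Literature.NumberTheory.EllipticCurves.Sprung2017
  Literature.NumberTheory.EllipticCurves.Rank1Residual Literature.NumberTheory.EllipticCurves.Rank1Residual.Typed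
  Literature.NumberTheory.EllipticCurves.Kobayashi2003 Literature.NumberTheory.EllipticCurves.IwasawaDual
  ZpExtension Summit.BirchSwinnertonDyer.Rank1Residual Summit.BirchSwinnertonDyer.Rank1Residual.Supersingular
  Summit.BirchSwinnertonDyer.Rank1Residual.X5.O1 Summit.BirchSwinnertonDyer.BirchSwinnertonDyer.Theses.ThetaPartnerAtTwo

namespace Summit.BirchSwinnertonDyer.BirchSwinnertonDyer.Theorems

namespace ThetaPartnerXRoute

/-! ## §1 Per curve: Kobayashi's `+` main conjecture at `2`, hence its Eisenstein half, from the CM partner -/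

/-- **Kobayashi's `+` main conjecture at `2` for a habitat curve from its rank-`0` CM partner (TP2 items by name).**
Binders: modularity `hmod` (PUB), K1 `SignedTransportAtTwo`, K2r0 `SignedMainConjectureCMTwoRankZero`, K3
`SignedKatoDivisibilityUpToAtTwo`; arguments: `W` (non-CM, `r_an = 0`, good supersingular at `2`, `a₂ = 0`), a CM curve `A`
(`r_an = 0`, good supersingular at `2`, `a₂ = 0`) and a Galois-equivariant `E[2] ≃ A[2]`. The partner's newform, period ratio
and Pollack pair at `2` are PRODUCED from `hmod` and `L(A,1) ≠ 0` (entire continuation from modularity), as in TP2's `closes`.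
[cite: GreenbergVatsal2000, Thm. (1.4)] [cite: Kobayashi2003, Conjecture (p. 2) and Thm. 4.1] [cite: PollackRubin2004, Thm. 7.3] -/
theorem kobayashiMainConjecture_two_of_cmPartner_of_thetaPartnerItems (hmod : nonempty_modularParametrizationData)
    (hT : SignedTransportAtTwo) (hCM : SignedMainConjectureCMTwoRankZero) (hKato : SignedKatoDivisibilityUpToAtTwo)
    (W : WeierstrassCurve ℚ) [W.IsElliptic] [W.IsGloballyMinimal] (hcm : ¬ W.HasCM) (hr : W.analyticRank = 0)
    (hss : GoodSS W 2) (ha : W.frobeniusTrace 2 = 0)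
    (A : WeierstrassCurve ℚ) [A.IsElliptic] [A.IsGloballyMinimal] (hAcm : A.HasCM) (hAr : A.analyticRank = 0)
    (hAss : GoodSS A 2) (hAa : A.frobeniusTrace 2 = 0)
    (e : WeierstrassCurve.geomTorsion W (2 : ℤ) ≃+ WeierstrassCurve.geomTorsion A (2 : ℤ))
    (he : ∀ (σ : Field.absoluteGaloisGroup ℚ) (P : WeierstrassCurve.geomTorsion W (2 : ℤ)), e (σ • P) = σ • e P) :
    KobayashiMainConjecture W 2 1 := by
  have hLrat : WeierstrassCurve.hasEntireLFunction_rat :=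
    WeierstrassCurve.hasEntireLFunction_rat_of_exists_isNewformOf
      (exists_isNewformOf_of_nonempty_modularParametrizationData hmod)
  -- the CM partner's analytic data: newform, period ratio, a Pollack pair at 2 (needs `L(A,1) ≠ 0`)
  have hLA : A.entireLFunction 1 ≠ 0 := (A.analyticRank_eq_zero_iff_holds (hLrat A)).mp hAr
  haveI : NeZero (A.conductorNorm ℤ) := ⟨(A.conductorNorm_pos_holds).ne'⟩
  obtain ⟨DmA⟩ := hmod A
  obtain ⟨ϖA, -, hϖAeq, -⟩ := DmA.exists_rat_mul_realPeriodRat_eq_plusPeriod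
  obtain ⟨LsA, LfA, -, hPPA⟩ :=
    Summit.BirchSwinnertonDyer.BirchSwinnertonDyer.Theorems.exists_isPollackPair_two DmA.isNewformOf hAss.1 hAa hLA
  obtain ⟨hmuA, hMCA⟩ := hCM A hAcm hAr hAss hAa
  exact hT W A hcm hr hss ha hAcm hAss hAa ⟨e, he⟩ DmA.f DmA.isNewformOf ϖA hϖAeq LsA LfA hPPA hmuA hMCA
    (hKato W hcm hr hss ha)

/-- **The Eisenstein half `KobayashiLowerDivisibility W 2 1` (= the conclusion of 19097's stub (3) at `W`) for a habitat
curve, from its CM partner and TP2's K1 + K2r0 + K3** (`h = 1` in the main conjecture).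
[cite: Kobayashi2003, Conjecture (p. 2)] [cite: GreenbergVatsal2000, Thm. (1.4)] [cite: PollackRubin2004, Thm. 7.3] -/
theorem kobayashiLowerDivisibility_two_of_cmPartner_of_thetaPartnerItems (hmod : nonempty_modularParametrizationData)
    (hT : SignedTransportAtTwo) (hCM : SignedMainConjectureCMTwoRankZero) (hKato : SignedKatoDivisibilityUpToAtTwo)
    (W : WeierstrassCurve ℚ) [W.IsElliptic] [W.IsGloballyMinimal] (hcm : ¬ W.HasCM) (hr : W.analyticRank = 0)
    (hss : GoodSS W 2) (ha : W.frobeniusTrace 2 = 0)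
    (A : WeierstrassCurve ℚ) [A.IsElliptic] [A.IsGloballyMinimal] (hAcm : A.HasCM) (hAr : A.analyticRank = 0)
    (hAss : GoodSS A 2) (hAa : A.frobeniusTrace 2 = 0)
    (e : WeierstrassCurve.geomTorsion W (2 : ℤ) ≃+ WeierstrassCurve.geomTorsion A (2 : ℤ))
    (he : ∀ (σ : Field.absoluteGaloisGroup ℚ) (P : WeierstrassCurve.geomTorsion W (2 : ℤ)), e (σ • P) = σ • e P) :
    KobayashiLowerDivisibility W 2 1 :=
  kobayashiLowerDivisibility_of_mainConjecture
    (kobayashiMainConjecture_two_of_cmPartner_of_thetaPartnerItems hmod hT hCM hKato W hcm hr hss ha A hAcm hAr hAss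
      hAa e he)

/-! ## §2 ∀-closed over the habitat: 19097's stub (3) restricted to the theta habitat -/

/-- **Stub (3) `stub_zeroKobayashiLower` ON THE THETA HABITAT from modularity + TP2's K1, K2r0, K3 BY NAME**: for every
non-CM `E` of analytic rank `0`, good supersingular at `2` with `a₂ = 0`, ADMITTING a rank-`0` CM partner `A` (good
supersingular at `2`, `a₂(A) = 0`) with `E[2] ≃ A[2]` Galois-equivariantly, `KobayashiLowerDivisibility E 2 1` holds — and
indeed `KobayashiMainConjecture E 2 1`. [cite: Kobayashi2003, Conjecture (p. 2) and Thm. 4.1]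
[cite: GreenbergVatsal2000, Thm. (1.4)] [cite: PollackRubin2004, Thm. 7.3] -/
theorem zeroKobayashiLower_onHabitat_of_thetaPartnerItems (hmod : nonempty_modularParametrizationData)
    (hT : SignedTransportAtTwo) (hCM : SignedMainConjectureCMTwoRankZero) (hKato : SignedKatoDivisibilityUpToAtTwo) :
    ∀ (W : WeierstrassCurve ℚ) [W.IsElliptic] [W.IsGloballyMinimal], ¬ W.HasCM → W.analyticRank = 0 →
      GoodSS W 2 → W.frobeniusTrace 2 = 0 →
      (∃ (A : WeierstrassCurve ℚ) (_ : A.IsElliptic) (_ : A.IsGloballyMinimal),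
          A.HasCM ∧ A.analyticRank = 0 ∧ GoodSS A 2 ∧ A.frobeniusTrace 2 = 0 ∧
            ∃ e : WeierstrassCurve.geomTorsion W (2 : ℤ) ≃+ WeierstrassCurve.geomTorsion A (2 : ℤ),
              ∀ (σ : Field.absoluteGaloisGroup ℚ) (P : WeierstrassCurve.geomTorsion W (2 : ℤ)), e (σ • P) = σ • e P) →
      KobayashiMainConjecture W 2 1 ∧ KobayashiLowerDivisibility W 2 1 := by
  intro W _ _ hcm hr hss ha hH
  obtain ⟨A, _, _, hAcm, hAr, hAss, hAa, e, he⟩ := hH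
  have hMC := kobayashiMainConjecture_two_of_cmPartner_of_thetaPartnerItems hmod hT hCM hKato W hcm hr hss ha A hAcm
    hAr hAss hAa e he
  exact ⟨hMC, kobayashiLowerDivisibility_of_mainConjecture hMC⟩

/-- **Stub (3) ON THE THETA HABITAT from modularity + TP2's K1, K2r0 and 19097's OWN stubs (1′) `stub_katoPub` + (4)
`stub_zeroColemanKato` (signatures VERBATIM)** — K3 being produced from (1′)+(4)
(`signedKatoDivisibilityUpToAtTwo_of_zeroColemanKato`). On 19 of the 208 `a₂ = 0` classes the MATH-BOUND Eisenstein half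
of line `signed_halves_two` thus reduces to TP2's transport (K1) and CM (K2r0) cruxes; off the habitat nothing is claimed.
[cite: Kobayashi2003, Conjecture (p. 2) and Thm. 4.1] [cite: Kato2004Asterisque, Thm. 12.4–12.5]
[cite: GreenbergVatsal2000, Thm. (1.4)] [cite: PollackRubin2004, Thm. 7.3] -/
theorem zeroKobayashiLower_onHabitat_of_signedTransport_of_stubs (hmod : nonempty_modularParametrizationData)
    (hKatoPub : Kato2004.thm12_4 ∧ Kato2004_fineSelmerDual_isTorsion)
    (hCK : ∀ (W : WeierstrassCurve ℚ) [W.IsElliptic] [W.IsGloballyMinimal],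
      ¬ W.HasCM → W.analyticRank = 0 → GoodSS W 2 → W.frobeniusTrace 2 = 0 →
      ∀ (κ : ZpExtension ℚ 2) (γ : Field.absoluteGaloisGroup ℚ),
        κ.IsCyclotomic → κ.IsTopGenerator γ → IsCyclotomicVariable 2 γ →
        ∀ [NeZero (W.conductorNorm ℤ)] (f : CuspForm (Gamma0 (W.conductorNorm ℤ)) 2),
          IsNewformOf W f → ∀ (ϖ : ℚ), (ϖ : ℝ) * W.realPeriodRat = plusPeriod f →
        ∀ (Lplus Lminus : IwasawaAlgebra 2), IsPollackPair f 2 Lplus Lminus →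
        ∀ (D : SignedSelmerDualData W κ γ 1) [ContinuousSMul ℤ_[2] (W.tateModule 2)],
          ∃ (I : Kato2004.IwasawaH1Data W 2 κ γ) (Y : W.FineSelmerDualData κ γ)
            (P : Submodule (IwasawaAlgebra 2) (IwasawaAlgebra 2))
            (loc : I.H →ₗ[IwasawaAlgebra 2] P) (toX : P →ₗ[IwasawaAlgebra 2] D.X)
            (δ : D.X →ₗ[IwasawaAlgebra 2] Y.X) (Z : Submodule (IwasawaAlgebra 2) I.H)
            (G : IwasawaAlgebra 2),
            Function.Exact loc toX ∧ Function.Exact toX δ ∧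
            G ∈ Submodule.map (P.subtype ∘ₗ loc) Z ∧
            iwasawaToPowerSeries 2 G =
              PowerSeries.C (ϖ : ℚ_[2]) * iwasawaToPowerSeries 2 (kobayashiL 1 Lplus Lminus) ∧
            (∀ 𝔭 : PrimeSpectrum (IwasawaAlgebra 2), 𝔭.asIdeal.height = 1 →
              PowerSeries.C (2 : ℤ_[2]) ∉ 𝔭.asIdeal →
              Literature.NumberTheory.EllipticCurves.Module.lengthAt (IwasawaAlgebra 2) Y.X 𝔭 ≤
                Literature.NumberTheory.EllipticCurves.Module.lengthAt (IwasawaAlgebra 2) (I.H ⧸ Z) 𝔭) ∧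
            (TwoAdicSurjective W →
              ∀ 𝔭 : PrimeSpectrum (IwasawaAlgebra 2), 𝔭.asIdeal.height = 1 →
                PowerSeries.C (2 : ℤ_[2]) ∈ 𝔭.asIdeal →
                Literature.NumberTheory.EllipticCurves.Module.lengthAt (IwasawaAlgebra 2) Y.X 𝔭 ≤
                  Literature.NumberTheory.EllipticCurves.Module.lengthAt (IwasawaAlgebra 2) (I.H ⧸ Z) 𝔭))
    (hT : SignedTransportAtTwo) (hCM : SignedMainConjectureCMTwoRankZero) :
    ∀ (W : WeierstrassCurve ℚ) [W.IsElliptic] [W.IsGloballyMinimal], ¬ W.HasCM → W.analyticRank = 0 →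
      GoodSS W 2 → W.frobeniusTrace 2 = 0 →
      (∃ (A : WeierstrassCurve ℚ) (_ : A.IsElliptic) (_ : A.IsGloballyMinimal),
          A.HasCM ∧ A.analyticRank = 0 ∧ GoodSS A 2 ∧ A.frobeniusTrace 2 = 0 ∧
            ∃ e : WeierstrassCurve.geomTorsion W (2 : ℤ) ≃+ WeierstrassCurve.geomTorsion A (2 : ℤ),
              ∀ (σ : Field.absoluteGaloisGroup ℚ) (P : WeierstrassCurve.geomTorsion W (2 : ℤ)), e (σ • P) = σ • e P) →
      KobayashiMainConjecture W 2 1 ∧ KobayashiLowerDivisibility W 2 1 :=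
  zeroKobayashiLower_onHabitat_of_thetaPartnerItems hmod hT hCM
    (signedKatoDivisibilityUpToAtTwo_of_zeroColemanKato hKatoPub hCK)

/-! ## §3 Integer-model door for the per-class displays -/

/-- **Kobayashi's `+` main conjecture at `2` AND its Eisenstein half for `M_E ⊗ ℚ` from a CERTIFIED CM partner `M_A ⊗ ℚ`**:
kernel inputs on the two integer models (`E` non-CM with `L(E,1) ≠ 0`, good supersingular at `2`, `a₂ = 0`; `A` CM with
`L(A,1) ≠ 0`, good supersingular at `2`, `a₂ = 0`), a Tschirnhaus pair `(q, r)` certifying `E[2] ≅ A[2]`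
(`exists_equivariant_addEquiv_geomTorsion_two_of_tschirnhaus`), modularity, and TP2's K1, K2r0, K3 BY NAME.
[cite: GreenbergVatsal2000, Thm. (1.4)] [cite: Kobayashi2003, Conjecture (p. 2) and Thm. 4.1] [cite: PollackRubin2004, Thm. 7.3]
[cite: SilvermanAEC2009, III.§1 and Cor. III.6.4(b)] -/
theorem kobayashiMainConjecture_two_baseChange_int_of_thetaPartner (ME MA : WeierstrassCurve ℤ)
    [(ME.baseChange ℚ).IsElliptic] [(ME.baseChange ℚ).IsGloballyMinimal]
    [(MA.baseChange ℚ).IsElliptic] [(MA.baseChange ℚ).IsGloballyMinimal]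
    (hmod : nonempty_modularParametrizationData) (hT : SignedTransportAtTwo) (hCM : SignedMainConjectureCMTwoRankZero)
    (hKato : SignedKatoDivisibilityUpToAtTwo)
    (hcm : ¬ (ME.baseChange ℚ).HasCM) (hL : (ME.baseChange ℚ).entireLFunction 1 ≠ 0)
    (hss : GoodSS (ME.baseChange ℚ) 2) (ha : (ME.baseChange ℚ).frobeniusTrace 2 = 0)
    (hAcm : (MA.baseChange ℚ).HasCM) (hLA : (MA.baseChange ℚ).entireLFunction 1 ≠ 0)
    (hAss : GoodSS (MA.baseChange ℚ) 2) (hAa : (MA.baseChange ℚ).frobeniusTrace 2 = 0)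
    (q r : ℚ[X])
    (hroot : ∀ ξ : AlgebraicClosure ℚ, Polynomial.aeval ξ (ME.baseChange ℚ).twoTorsionPolynomial.toPoly = 0 →
      Polynomial.aeval (Polynomial.aeval ξ q) (MA.baseChange ℚ).twoTorsionPolynomial.toPoly = 0)
    (hinv : ∀ ξ : AlgebraicClosure ℚ, Polynomial.aeval ξ (ME.baseChange ℚ).twoTorsionPolynomial.toPoly = 0 →
      Polynomial.aeval (Polynomial.aeval ξ q) r = ξ) :
    KobayashiMainConjecture (ME.baseChange ℚ) 2 1 ∧ KobayashiLowerDivisibility (ME.baseChange ℚ) 2 1 := by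
  obtain ⟨e, he⟩ := exists_equivariant_addEquiv_geomTorsion_two_of_tschirnhaus (K := ℚ) two_ne_zero
    (ME.baseChange ℚ) (MA.baseChange ℚ) q r hroot hinv
  have hMC := kobayashiMainConjecture_two_of_cmPartner_of_thetaPartnerItems hmod hT hCM hKato (ME.baseChange ℚ) hcm
    (analyticRank_eq_zero_of_entireLFunction_one_ne_zero _ hL) hss ha (MA.baseChange ℚ) hAcm
    (analyticRank_eq_zero_of_entireLFunction_one_ne_zero _ hLA) hAss hAa e he
  exact ⟨hMC, kobayashiLowerDivisibility_of_mainConjecture hMC⟩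

end ThetaPartnerXRoute

end Summit.BirchSwinnertonDyer.BirchSwinnertonDyer.Theorems

end
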